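import Mathlib
import Summits.Ventures.HodgeRepro.Tier4.Line1.RTFSetting
import Summits.Ventures.HodgeRepro.Tier4.Line1.OrbitalTools
import Summits.Ventures.HodgeRepro.Tier4.Line1.OrbitalPositive
import Summits.Ventures.HodgeRepro.Tier4.Line1.OrbitalNonzero
import Summits.Ventures.HodgeRepro.Tier4.Line1.RealisedSetting
import Summits.Ventures.HodgeRepro.Tier4.Line1.IsolatingTestsLevel
import Summits.Ventures.HodgeRepro.Tier4.Line1.IsolatingTestsDeepLevel
import Summits.Ventures.HodgeRepro.Tier4.Line1.LeftTypeOfMatrixCoeff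
import Summits.Ventures.HodgeRepro.Tier4.Line1.ArchMatrixCoeff
import Summits.Ventures.HodgeRepro.Tier4.Line1.FinLevelCompact
import Summits.Ventures.HodgeRepro.Tier4.Line1.DoubleCosetIsolation
import Summits.Ventures.HodgeRepro.Tier4.Line1.ArchDensity

/-!
# Tier4/Line1/IsolatingTestsFiniteRankType — (S1b-BRIDGE): the isolating pair of J2 with a FIRST test of finite-rank
left-`K_f(N) × G_∞`-type, on a plane with compact archimedean part (the F2′ → (S1b) bridge as one kernel theorem)

Blind re-derivation cell `pub-hodge-repro`, Tier 4 (README §9–§10), seat t4-L1-p4 (gen 4), LINE L1; the cut named by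
t4-plan-1 (S14053, held by this seat S14050/S14089).  Target tree path
`lean/Summits/Ventures/HodgeRepro/Tier4/Line1/IsolatingTestsFiniteRankType.lean`.  Imports this seat's
DoubleCosetIsolation (F2‴ `exists_level_isolating_doubleCoset`) and ArchDensity (`exists_finiteRankLeftType_approx_deep`),
p2's OrbitalPositive (`exists_test_orbital_re_pos`) / OrbitalNonzero (`exists_conv_orbital_close`) / OrbitalTools
(`norm_orbital_sub_le`, `finite_hit_closure`, `eq_zero_of_notMem_hit`) / LeftTypeOfMatrixCoeff (`HasFiniteRankLeftType`),
p3's RealisedSetting and IsolatingTestsLevel (the instance glue).  0 print.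

ROUTE (A) of S14053 — APPROXIMATION, in the generic form `exists_pair_orbital_ne_zero_of_approx`: p3's
`exists_pair_orbital_ne_zero_level` with the averaging step replaced by an ABSTRACT DENSITY HYPOTHESIS for a shape
predicate `P` on a compact open `X ∋ γ₀`: a bump `f₀` at `γ₀` supported in `X` with `Re O_{γ₀}(f₀) = ε > 0`
(`exists_test_orbital_re_pos`), an approximant `h` of shape `P`, supported in `X`, with `‖h − f₀‖_∞ ≤ ε / (2 (L + 1))`
(`L` the Lipschitz constant of the orbital term on `X`: `norm_orbital_sub_le` over the finite hit set of `X`), so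
`Re O_{γ₀}(h) > ε / 2`; then `f₂` from `exists_conv_orbital_close` with `f₁ ⋆ f₂` supported in `X` and
`O_{γ₀}(f₁ ⋆ f₂) ≠ 0`.  ON THE INSTANCE (`exists_isolating_tests_finiteRankType`, `hC : IsCompact (archImage W)`
displayed — F-L1-ARCH, p2's typed form of «`G_∞` is compact»): `X := K_{N₁} · {γ₀} · K_{N₁}`, the isolating double coset
of F2‴ (compact, open, left-`K_{N₁}`-invariant); `P h := ∃ N ≠ 0, HasFiniteRankLeftType (finLevel W N) h`; the density
hypothesis is ArchDensity's `exists_finiteRankLeftType_approx_deep` (Stone–Weierstrass on the coset indicators and the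
archimedean matrix entries, after a left average over a deep `K(N)`); `geoSupport (f₁ ⋆ f₂) = {o₀}` from the
isolation of `X` and `orbital_eq_zero_of_not_mem`.  `defined_inputs_realisable_finiteRankType` is the DEFINED block of
the residual in this shape (plan-1's statement S14053 with `hC` in place of `htot`; `isOpen_finLevel hN` is the openness
the (S1b) consumer `exists_spec_of_finiteRankLeftType` asks for).

WHAT IS NOT CLAIMED: nothing about (S1a), the dictionary `tf`, (S3′), or `P_T4`; the archimedean compactness is a
displayed hypothesis (true on totally definite planes, p2's `isCompact_closure_archImage`).  Nothing here says anything
about the status of the Hodge conjecture for CM abelian varieties, which is NOT proved (HC_CM is NOT proved by anyone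
in this repository).
-/

set_option autoImplicit false

noncomputable section

namespace Summit.Ventures.HodgeRepro.Tier4.Line1

open MeasureTheory Topology
open scoped Pointwise

namespace RTF

variable {G : Type} [Group G] [TopologicalSpace G] [IsTopologicalGroup G] [MeasurableSpace G] [BorelSpace G]
  (S : Setting G)

/-- **the isolating pair with a first test of a prescribed SHAPE, generically** (route (A) of S14053): for a regular
rational `γ₀` in a compact open `X`, and a shape predicate `P` for which every test function vanishing off `X` is
uniformly approximable by test functions of shape `P` vanishing off `X`, there are test functions `f₁` (of shape `P`)
and `f₂` with `f₁ ⋆ f₂` a test function supported in `X` and a non-zero orbital term at `γ₀`. -/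
theorem Setting.exists_pair_orbital_ne_zero_of_approx [Countable S.Gk] [LocallyCompactSpace G] [T2Space G]
    {χ : S.T → ℂ} {χ' : S.T' → ℂ} (hχ : S.IsCharacter χ) (hχ' : S.IsCharacter' χ')
    (hZ : S.CentralMatch χ χ') (γ₀ : S.Gk)
    (hreg : ∀ t ∈ S.T, ∀ t' ∈ S.T', t⁻¹ * γ₀ * t' = γ₀ → t ∈ S.Z ∧ t' = t) {X : Set G} (hXo : IsOpen X)
    (hXc : IsCompact X) (hγ : (γ₀ : G) ∈ X) (P : (G → ℂ) → Prop)
    (hdense : ∀ f₀ : G → ℂ, IsTest f₀ → (∀ g, g ∉ X → f₀ g = 0) → ∀ η : ℝ, 0 < η →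
      ∃ h : G → ℂ, IsTest h ∧ (∀ g, g ∉ X → h g = 0) ∧ P h ∧ ∀ g, ‖h g - f₀ g‖ ≤ η) :
    ∃ f₁ f₂ : G → ℂ, IsTest f₁ ∧ IsTest f₂ ∧ IsTest (S.conv f₁ f₂) ∧ tsupport (S.conv f₁ f₂) ⊆ X ∧
      S.orbital χ χ' (S.orbitOf γ₀) (S.conv f₁ f₂) ≠ 0 ∧ P f₁ := by
  classical
  obtain ⟨f₀, h₀, hsub, hpos⟩ := S.exists_test_orbital_re_pos hχ hχ' hZ γ₀ hreg hXo hγ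
  set ε : ℝ := (S.orbital χ χ' (S.orbitOf γ₀) f₀).re with hεdef
  have hXcl : IsClosed X := hXc.isClosed
  have hf₀X : ∀ g, g ∉ X → f₀ g = 0 := fun g hg =>
    image_eq_zero_of_notMem_tsupport fun h => hg (hsub h)
  -- the Lipschitz constant of the orbital term on `X`
  set Γ : Finset S.Gk := (S.finite_hit_closure hXc).toFinset with hΓdef
  set L : ℝ := (Γ.card : ℝ) * S.μT.real S.DT * S.μT'.real S.DT' with hL
  have hL0 : 0 ≤ L := by positivity
  set η : ℝ := ε / (2 * (L + 1)) with hηdef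
  have hη : 0 < η := by positivity
  obtain ⟨h, hh, hhX, hP, hclose⟩ := hdense f₀ h₀ hf₀X η hη
  have hhsub : tsupport h ⊆ X := closure_minimal (Function.support_subset_iff'.2 hhX) hXcl
  have hΓ₀ : ∀ γ : S.Gk, γ ∉ Γ → ∀ t ∈ closure S.DT, ∀ t' ∈ closure S.DT', f₀ ((t : G)⁻¹ * γ * t') = 0 :=
    fun γ hγ t ht t' ht' => S.eq_zero_of_notMem_hit hXc hsub hγ ht ht'
  have hΓh : ∀ γ : S.Gk, γ ∉ Γ → ∀ t ∈ closure S.DT, ∀ t' ∈ closure S.DT', h ((t : G)⁻¹ * γ * t') = 0 :=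
    fun γ hγ t ht t' ht' => S.eq_zero_of_notMem_hit hXc hhsub hγ ht ht'
  have hcl : ‖S.orbital χ χ' (S.orbitOf γ₀) h - S.orbital χ χ' (S.orbitOf γ₀) f₀‖ ≤ L * η := by
    calc ‖S.orbital χ χ' (S.orbitOf γ₀) h - S.orbital χ χ' (S.orbitOf γ₀) f₀‖
        ≤ (Γ.card : ℝ) * η * S.μT.real S.DT * S.μT'.real S.DT' :=
          S.norm_orbital_sub_le hχ hχ' _ hh h₀ hΓh hΓ₀ hclose
      _ = L * η := by rw [hL]; ring
  have hsmall : L * η < ε / 2 := by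
    rw [hηdef]
    have : L * (ε / (2 * (L + 1))) = ε / 2 * (L / (L + 1)) := by field_simp
    rw [this]
    have hlt : L / (L + 1) < 1 := by rw [div_lt_one (by linarith)]; linarith
    have hε2 : 0 < ε / 2 := by positivity
    nlinarith
  have hOh : 0 < (S.orbital χ χ' (S.orbitOf γ₀) h).re := by
    have hre := Complex.abs_re_le_norm (S.orbital χ χ' (S.orbitOf γ₀) h - S.orbital χ χ' (S.orbitOf γ₀) f₀)
    rw [Complex.sub_re] at hre
    have hre' : |(S.orbital χ χ' (S.orbitOf γ₀) h).re - ε| < ε / 2 := lt_of_le_of_lt (hre.trans hcl) hsmall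
    rw [abs_lt] at hre'
    linarith
  -- the second factor
  obtain ⟨f₂, h₂, hconv, hconvU, hcl₂⟩ :=
    S.exists_conv_orbital_close hχ hχ' (S.orbitOf γ₀) hh hXo hhsub hOh
  refine ⟨h, f₂, hh, h₂, hconv, hconvU, ?_, hP⟩
  intro h0
  rw [h0, zero_sub, norm_neg] at hcl₂
  exact absurd (Complex.abs_re_le_norm _) (not_le.2 (lt_of_lt_of_le hcl₂ (le_abs_self _)))

end RTF

section DoubleCoset

variable {G : Type} [Group G] (K : Subgroup G)

/-- membership in the double coset `K · x · K`. -/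
theorem mem_doubleCoset_iff (x g : G) :
    g ∈ (K : Set G) * {x} * (K : Set G) ↔ ∃ b ∈ K, g * b⁻¹ * x⁻¹ ∈ K := by
  constructor
  · intro hg
    obtain ⟨y, hy, b, hb, rfl⟩ := Set.mem_mul.1 hg
    refine ⟨b, hb, ?_⟩
    rw [mul_inv_cancel_right]
    exact (mem_coset_iff K x y).1 hy
  · rintro ⟨b, hb, h⟩
    have := Set.mul_mem_mul ((mem_coset_iff K x (g * b⁻¹)).2 h) hb
    rwa [inv_mul_cancel_right] at this

/-- the double coset `K · x · K` is left-`K`-invariant. -/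
theorem doubleCoset_left_invariant {k₀ : G} (hk : k₀ ∈ K) (x g : G) :
    k₀ * g ∈ (K : Set G) * {x} * (K : Set G) ↔ g ∈ (K : Set G) * {x} * (K : Set G) := by
  rw [mem_doubleCoset_iff, mem_doubleCoset_iff]
  constructor
  · rintro ⟨b, hb, h⟩
    refine ⟨b, hb, ?_⟩
    rw [mul_assoc, mul_assoc, K.mul_mem_cancel_left hk, ← mul_assoc] at h
    exact h
  · rintro ⟨b, hb, h⟩
    refine ⟨b, hb, ?_⟩
    rw [mul_assoc, mul_assoc, K.mul_mem_cancel_left hk, ← mul_assoc]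
    exact h

end DoubleCoset

section Instance

open NumberField Common

variable {k : Type} [Field k] [NumberField k] (W : PlaneData k) [MeasurableSpace (GA W)] [BorelSpace (GA W)]
  (hW : IsDefinite W) (hg : IsGenuineRow W) (R : RTFData W) (μ : Measure (GA W)) [μ.IsHaarMeasure]
  [R.μT.IsHaarMeasure] [R.μT'.IsHaarMeasure] (hT : IsCompact (closure R.DT)) (hT' : IsCompact (closure R.DT'))

/-- **(S1b-BRIDGE) — J2 with a first test of finite-rank left-`K_f(N) × G_∞`-type**: with `hC : IsCompact (archImage W)`
(F-L1-ARCH), for the defined tori and characters (continuous, unitary) there are a level `N ≠ 0`, test functions `f₁`,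
`f₂` and ONE rational double coset `o₀` with `f₁ ⋆ f₂` meeting exactly `o₀` on `DT × DT′`, a non-zero orbital term, and
`f₁` of finite-rank left-`finLevel W N`-type — the SHAPE of p2's `exists_spec_of_finiteRankLeftType` (`finLevel W N` is
open, `isOpen_finLevel hN`). -/
theorem exists_isolating_tests_finiteRankType (hC : IsCompact (archImage W)) (hc : Continuous R.chi)
    (hu : ∀ a, ‖R.chi a‖ = 1) (hc' : Continuous R.chi') (hu' : ∀ a, ‖R.chi' a‖ = 1) :
    ∃ (N : ℕ) (f₁ f₂ : GA W → ℂ) (o₀ : (Setting.ofAdelic W hW hg R μ hT hT').Orbit), N ≠ 0 ∧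
      RTF.IsTest f₁ ∧ RTF.IsTest f₂ ∧ RTF.IsTest ((Setting.ofAdelic W hW hg R μ hT hT').conv f₁ f₂) ∧
      (Setting.ofAdelic W hW hg R μ hT hT').geoSupport ((Setting.ofAdelic W hW hg R μ hT hT').conv f₁ f₂) = {o₀} ∧
      (Setting.ofAdelic W hW hg R μ hT hT').orbital R.chi R.chi' o₀
        ((Setting.ofAdelic W hW hg R μ hT hT').conv f₁ f₂) ≠ 0 ∧
      RTF.HasFiniteRankLeftType (finLevel W N) f₁ := by
  haveI : Countable (Setting.ofAdelic W hW hg R μ hT hT').Gk := rationalPoints_countable W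
  haveI : T2Space (GA W) := t2Space_GA W
  haveI : LocallyCompactSpace (GA W) := locallyCompact_GA W
  obtain ⟨γ₀, hreg⟩ := exists_regular_rational W hW hg
  have hreg' : IsRegularRational W γ₀ := isRegularRational_of_isLinRegular W γ₀ hreg
  -- the isolating double coset
  obtain ⟨N₁, hN₁, hiso⟩ := exists_level_isolating_doubleCoset W hW hg R μ hT hT' hC γ₀ hreg
  have hKc : IsCompact (finLevel W N₁ : Set (GA W)) := isCompact_finLevel W hC hN₁
  have hKo : IsOpen (finLevel W N₁ : Set (GA W)) := isOpen_finLevel W hN₁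
  have hXc : IsCompact ((finLevel W N₁ : Set (GA W)) * {(γ₀ : GA W)} * (finLevel W N₁ : Set (GA W))) :=
    (hKc.mul isCompact_singleton).mul hKc
  have hXo : IsOpen ((finLevel W N₁ : Set (GA W)) * {(γ₀ : GA W)} * (finLevel W N₁ : Set (GA W))) :=
    (hKo.mul_right).mul_right
  have hγX : (γ₀ : GA W) ∈ (finLevel W N₁ : Set (GA W)) * {(γ₀ : GA W)} * (finLevel W N₁ : Set (GA W)) := by
    have := Set.mul_mem_mul (Set.mul_mem_mul (finLevel W N₁).one_mem (Set.mem_singleton (γ₀ : GA W)))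
      (finLevel W N₁).one_mem
    simpa using this
  have hKX : ∀ k ∈ finLevel W N₁, ∀ g,
      k * g ∈ (finLevel W N₁ : Set (GA W)) * {(γ₀ : GA W)} * (finLevel W N₁ : Set (GA W)) ↔
        g ∈ (finLevel W N₁ : Set (GA W)) * {(γ₀ : GA W)} * (finLevel W N₁ : Set (GA W)) :=
    fun k hk g => doubleCoset_left_invariant (finLevel W N₁) hk _ g
  -- the density hypothesis for the shape `∃ N ≠ 0, HasFiniteRankLeftType (finLevel W N)`
  have hdense : ∀ f₀ : GA W → ℂ, RTF.IsTest f₀ →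
      (∀ g, g ∉ (finLevel W N₁ : Set (GA W)) * {(γ₀ : GA W)} * (finLevel W N₁ : Set (GA W)) → f₀ g = 0) →
      ∀ η : ℝ, 0 < η → ∃ h : GA W → ℂ, RTF.IsTest h ∧
        (∀ g, g ∉ (finLevel W N₁ : Set (GA W)) * {(γ₀ : GA W)} * (finLevel W N₁ : Set (GA W)) → h g = 0) ∧
        (∃ N : ℕ, N ≠ 0 ∧ RTF.HasFiniteRankLeftType (finLevel W N) h) ∧ ∀ g, ‖h g - f₀ g‖ ≤ η := by
    intro f₀ h₀ hf₀ η hη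
    obtain ⟨N, hN, h, hht, hhX, hhtype, hhclose⟩ :=
      exists_finiteRankLeftType_approx_deep W hC hN₁ hXc hXo hKX h₀ hf₀ hη
    exact ⟨h, hht, hhX, ⟨N, hN, hhtype⟩, hhclose⟩
  obtain ⟨f₁, f₂, h₁, h₂, hconv, hsupp, hne, N, hN, htype⟩ :=
    (Setting.ofAdelic W hW hg R μ hT hT').exists_pair_orbital_ne_zero_of_approx
      (isCharacter_ofAdelic W hW hg R μ hT hT' hc hu) (isCharacter'_ofAdelic W hW hg R μ hT hT' hc' hu')
      (centralMatch_ofAdelic W hW hg R μ hT hT') γ₀ hreg' hXo hXc hγX _ hdense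
  refine ⟨N, f₁, f₂, (Setting.ofAdelic W hW hg R μ hT hT').orbitOf γ₀, hN, h₁, h₂, hconv, ?_, hne, htype⟩
  ext o
  constructor
  · rintro ⟨t, ht, t', ht', γ, rfl, hγne⟩
    exact hiso t (subset_closure ht) t' (subset_closure ht') γ
      (hsupp (subset_tsupport _ (Function.mem_support.mpr hγne)))
  · intro ho
    rw [Set.mem_singleton_iff] at ho
    subst ho
    by_contra h
    exact hne ((Setting.ofAdelic W hW hg R μ hT hT').orbital_eq_zero_of_not_mem R.chi R.chi' h)

/-- **The DEFINED block of the residual in the (S1b) shape** (plan-1's `defined_inputs_realisable_finiteType`, S14053,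
with the archimedean compactness displayed): an adapted ONB `(τ, φ, n)` and an isolating pair `(f₁, f₂, o₀)` at a level
`N ≠ 0` with `f₁` of finite-rank left-`finLevel W N`-type. -/
theorem defined_inputs_realisable_finiteRankType (hC : IsCompact (archImage W)) (hc : Continuous R.chi)
    (hu : ∀ a, ‖R.chi a‖ = 1) (hc' : Continuous R.chi') (hu' : ∀ a, ‖R.chi' a‖ = 1) :
    ∃ (τ : ℕ → Set (GA W → ℂ)) (φ : ℕ → GA W → ℂ) (n : ℕ → ℕ),
      (Setting.ofAdelic W hW hg R μ hT hT').IsAdaptedONB τ φ n ∧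
      ∃ (N : ℕ) (f₁ f₂ : GA W → ℂ) (o₀ : (Setting.ofAdelic W hW hg R μ hT hT').Orbit), N ≠ 0 ∧
        RTF.IsTest f₁ ∧ RTF.IsTest f₂ ∧ RTF.IsTest ((Setting.ofAdelic W hW hg R μ hT hT').conv f₁ f₂) ∧
        (Setting.ofAdelic W hW hg R μ hT hT').geoSupport ((Setting.ofAdelic W hW hg R μ hT hT').conv f₁ f₂) = {o₀} ∧
        (Setting.ofAdelic W hW hg R μ hT hT').orbital R.chi R.chi' o₀
          ((Setting.ofAdelic W hW hg R μ hT hT').conv f₁ f₂) ≠ 0 ∧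
        RTF.HasFiniteRankLeftType (finLevel W N) f₁ := by
  obtain ⟨τ, φ, n, hB⟩ := exists_adaptedONB W hW hg R μ hT hT'
  exact ⟨τ, φ, n, hB, exists_isolating_tests_finiteRankType W hW hg R μ hT hT' hC hc hu hc' hu'⟩

end Instance

end Summit.Ventures.HodgeRepro.Tier4.Line1

end
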